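import Mathlib
import Summits.KontsevichZagierPeriods.Zeta5Search.ThirdOrderDigit
import Summits.KontsevichZagierPeriods.Zeta5Search.TypeSpacePoints
import Summits.KontsevichZagierPeriods.Zeta5Search.SecondOrderAssembly
import HarnessLib

/-!
# ζ(5) search — THIRD-ORDER TYPE FUNCTIONALS `ŵ₃(T)`, `v̂₃(T)` of a level class (tools for gen-2 g10's THEOREM A⁗)

Cell `pub-zeta5` (HONEST FRAMING: systematic search; no irrationality claim unless certified), typer seat generation 12.
The `SecondOrderTypes` layer (typer g11: `typeW2`, `typeV2`, `τ`) extended to the third-order invariants of `ThirdOrderDigit.lean`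
(gen-2 g10): `typeW3` / `typeV3` (= `ŵ[η²Φ_T]`, `v̂[η²Φ_T]`) with the level lemmas `wHat3_level₀`, `vHat3_level₀` (weak centre hypothesis),
their `p`-integrality (`padicNorm_wHat3_le_one`, `padicNorm_vHat3_le_one`), and **`functionals_conj_of_pal`**: a palindromic
non-self-conjugate level class and its conjugate class have the same `ŵ, ŵ₂, ŵ₃, v̂, v̂₂, v̂₃` and the same top level (the deep-pair input of
the third-order pair identity (P0), REPORT-gen2-g10 §6.4).  Nothing here bears on irrationality.
-/

noncomputable section

open Finset PowerSeries

namespace Summit.KontsevichZagierPeriods.Zeta5Search.SecondOrder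

open Summit.KontsevichZagierPeriods.Zeta5Search.DualSeries (InBox)
open Summit.KontsevichZagierPeriods.Zeta5Search.CasoratianValuation (InPolytope)
open Summit.KontsevichZagierPeriods.Zeta5Search.ClusterValuation
open Summit.KontsevichZagierPeriods.Zeta5Search.PadicSeries
open Summit.KontsevichZagierPeriods.Zeta5Search.LevelClass (typeRho typeW typeV typeExp classSet_level level_injective level_mem
  classPoles_level typeRho_congr typeW_congr typeV_congr)
open Summit.KontsevichZagierPeriods.Zeta5Search.CellA (padicNorm_classRho_le_one padicNorm_pow_eq padicNorm_harm_le_one)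
open Summit.KontsevichZagierPeriods.Zeta5Search.CellKit (conj_level netExp_conj_level)
open Literature.NumberTheory.Transcendental.BallRivoal (harm)

variable {p : ℕ} [hp : Fact p.Prime]

/-! ## §1 Third-order type functionals -/

/-- `ŵ₃(T) := Σ_{poles i} (i² ρ^T_{i,3} [n_i ≥ 3] + 2i ρ^T_{i,4} [n_i ≥ 4] + ρ^T_{i,5} [n_i ≥ 5])` = `ŵ[η²Φ_T]`. -/
def typeW3 (L : ℕ) (e : ℕ → ℤ) : ℚ :=
  ∑ i ∈ (range (L + 1)).filter (fun i => e i < 0),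
    ((if e i ≤ -3 then ((i : ℕ) : ℚ) ^ 2 * typeRho L e i 3 else 0)
      + (if e i ≤ -4 then 2 * ((i : ℕ) : ℚ) * typeRho L e i 4 else 0)
      + (if e i ≤ -5 then typeRho L e i 5 else 0))

/-- `v̂₃(T) := Σ_{poles i} Σ_{σ=1}^{n_i} (−1)^σ (i² ρ_{i,σ} + 2i ρ_{i,σ+1}[σ+1 ≤ n_i] + ρ_{i,σ+2}[σ+2 ≤ n_i]) H^{(σ)}_i` = `v̂[η²Φ_T]`. -/
def typeV3 (L : ℕ) (e : ℕ → ℤ) : ℚ :=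
  ∑ i ∈ (range (L + 1)).filter (fun i => e i < 0), ∑ σ ∈ Icc 1 (-e i).toNat,
    (-1 : ℚ) ^ σ * (((i : ℕ) : ℚ) ^ 2 * typeRho L e i σ
        + (if (σ : ℤ) + 1 ≤ -e i then 2 * ((i : ℕ) : ℚ) * typeRho L e i (σ + 1) else 0)
        + (if (σ : ℤ) + 2 ≤ -e i then typeRho L e i (σ + 2) else 0)) * harm σ i

omit hp in
/-- `typeW3` only sees `e₀,…,e_L`. -/
theorem typeW3_congr {L : ℕ} {e e' : ℕ → ℤ} (h : ∀ k ≤ L, e k = e' k) : typeW3 L e = typeW3 L e' := by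
  unfold typeW3
  rw [filter_congr (fun i hi => by rw [h i (by have := mem_range.1 hi; omega)])]
  refine sum_congr rfl fun i hi => ?_
  have hiL : i ≤ L := by have := mem_range.1 (mem_filter.1 hi).1; omega
  rw [h i hiL, typeRho_congr h hiL, typeRho_congr h hiL, typeRho_congr h hiL]

omit hp in
/-- `typeV3` only sees `e₀,…,e_L`. -/
theorem typeV3_congr {L : ℕ} {e e' : ℕ → ℤ} (h : ∀ k ≤ L, e k = e' k) : typeV3 L e = typeV3 L e' := by
  unfold typeV3
  rw [filter_congr (fun i hi => by rw [h i (by have := mem_range.1 hi; omega)])]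
  refine sum_congr rfl fun i hi => ?_
  have hiL : i ≤ L := by have := mem_range.1 (mem_filter.1 hi).1; omega
  rw [h i hiL]
  refine sum_congr rfl fun σ _ => ?_
  rw [typeRho_congr h hiL, typeRho_congr h hiL, typeRho_congr h hiL]

/-! ## §2 Level lemmas under the weak centre hypothesis -/

section Level

variable (b : ℕ → ℤ) {x L : ℕ} (hx : x < p) (hL : x + L * p ≤ (b 0).toNat) (hL' : (b 0).toNat < x + L * p + p)
include hx hL hL'

/-- **`ŵ₃_x = ŵ₃(T)`** (no odd centre in the class). -/
theorem wHat3_level₀ (e : ℕ → ℤ) (he : ∀ k ≤ L, netExp b (x + k * p) = e k)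
    (hc0 : ¬ (¬ (2 : ℤ) ∣ b 0 ∧ CentreIn b p x)) : wHat3 b p x = typeW3 L e := by
  have hP : (classSet b p x).filter (fun q => netExp b q < 0) =
      ((range (L + 1)).filter fun k => e k < 0).image fun k => x + k * p := classPoles_level b hx hL hL' e he
  unfold wHat3 typeW3 classPoles
  rw [hP, sum_image (fun a _ c _ h => level_injective hp.out.pos x h)]
  refine sum_congr rfl fun k hk => ?_
  have hkL : k ≤ L := by have := mem_range.1 (mem_filter.1 hk).1; omega
  rw [he k hkL, level_div hx, classRho_level₀ b hx hL hL' e he hc0 hkL, classRho_level₀ b hx hL hL' e he hc0 hkL,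
    classRho_level₀ b hx hL hL' e he hc0 hkL]

/-- **`v̂₃_x = v̂₃(T)`** (no odd centre in the class). -/
theorem vHat3_level₀ (e : ℕ → ℤ) (he : ∀ k ≤ L, netExp b (x + k * p) = e k)
    (hc0 : ¬ (¬ (2 : ℤ) ∣ b 0 ∧ CentreIn b p x)) : vHat3 b p x = typeV3 L e := by
  have hP : (classSet b p x).filter (fun q => netExp b q < 0) =
      ((range (L + 1)).filter fun k => e k < 0).image fun k => x + k * p := classPoles_level b hx hL hL' e he
  unfold vHat3 typeV3 classPoles
  rw [hP, sum_image (fun a _ c _ h => level_injective hp.out.pos x h)]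
  refine sum_congr rfl fun k hk => ?_
  have hkL : k ≤ L := by have := mem_range.1 (mem_filter.1 hk).1; omega
  rw [he k hkL, level_div hx]
  refine sum_congr rfl fun σ _ => ?_
  rw [classRho_level₀ b hx hL hL' e he hc0 hkL, classRho_level₀ b hx hL hL' e he hc0 hkL,
    classRho_level₀ b hx hL hL' e he hc0 hkL]

end Level

/-! ## §3 Integrality -/

/-- `‖ŵ₃_x‖ ≤ 1`. -/
theorem padicNorm_wHat3_le_one (b : ℕ → ℤ) (h0 : 0 ≤ b 0) (hn : (b 0).toNat < p ^ 2) (hp2 : p ≠ 2) (x : ℕ) :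
    padicNorm p (wHat3 b p x) ≤ 1 := by
  unfold wHat3
  refine padicNorm.sum_le' (fun q hq => ?_) zero_le_one
  have hqN : q ≤ (b 0).toNat := ((mem_classSet_iff b x q).1 (mem_filter.1 hq).1).1
  have hl : padicNorm p ((q / p : ℕ) : ℚ) ≤ 1 := by simpa using padicNorm.of_nat (p := p) (q / p)
  refine (padicNorm.nonarchimedean (p := p)).trans (max_le ((padicNorm.nonarchimedean (p := p)).trans (max_le ?_ ?_)) ?_)
  · split_ifs
    · rw [padicNorm.mul, padicNorm_pow_eq]
      calc _ ≤ (1 : ℚ) ^ 2 * 1 := mul_le_mul (pow_le_pow_left₀ (padicNorm.nonneg _) hl 2)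
            (padicNorm_classRho_le_one b h0 hqN hn hp2 3) (padicNorm.nonneg _) (by positivity)
        _ = 1 := by ring
    · rw [padicNorm.zero]; exact zero_le_one
  · split_ifs
    · rw [padicNorm.mul, padicNorm.mul]
      calc _ ≤ (1 : ℚ) * 1 * 1 := mul_le_mul (mul_le_mul (by simpa using padicNorm.of_nat (p := p) 2) hl
            (padicNorm.nonneg _) zero_le_one) (padicNorm_classRho_le_one b h0 hqN hn hp2 4) (padicNorm.nonneg _) (by positivity)
        _ = 1 := by ring
    · rw [padicNorm.zero]; exact zero_le_one
  · split_ifs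
    · exact padicNorm_classRho_le_one b h0 hqN hn hp2 5
    · rw [padicNorm.zero]; exact zero_le_one

/-- `‖v̂₃_x‖ ≤ 1`. -/
theorem padicNorm_vHat3_le_one (b : ℕ → ℤ) (h0 : 0 ≤ b 0) (hn : (b 0).toNat < p ^ 2) (hp2 : p ≠ 2) (x : ℕ) :
    padicNorm p (vHat3 b p x) ≤ 1 := by
  unfold vHat3
  refine padicNorm.sum_le' (fun q hq => padicNorm.sum_le' (fun σ _ => ?_) zero_le_one) zero_le_one
  have hqN : q ≤ (b 0).toNat := ((mem_classSet_iff b x q).1 (mem_filter.1 hq).1).1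
  have hlp : q / p < p := Nat.div_lt_of_lt_mul (by nlinarith [hqN, hn])
  have hl : padicNorm p ((q / p : ℕ) : ℚ) ≤ 1 := by simpa using padicNorm.of_nat (p := p) (q / p)
  have hin : padicNorm p (((q / p : ℕ) : ℚ) ^ 2 * classRho b p q σ
      + (if (σ : ℤ) + 1 ≤ -netExp b q then 2 * ((q / p : ℕ) : ℚ) * classRho b p q (σ + 1) else 0)
      + (if (σ : ℤ) + 2 ≤ -netExp b q then classRho b p q (σ + 2) else 0)) ≤ 1 := by
    refine (padicNorm.nonarchimedean (p := p)).trans (max_le ((padicNorm.nonarchimedean (p := p)).trans (max_le ?_ ?_)) ?_)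
    · rw [padicNorm.mul, padicNorm_pow_eq]
      calc _ ≤ (1 : ℚ) ^ 2 * 1 := mul_le_mul (pow_le_pow_left₀ (padicNorm.nonneg _) hl 2)
            (padicNorm_classRho_le_one b h0 hqN hn hp2 σ) (padicNorm.nonneg _) (by positivity)
        _ = 1 := by ring
    · split_ifs
      · rw [padicNorm.mul, padicNorm.mul]
        calc _ ≤ (1 : ℚ) * 1 * 1 := mul_le_mul (mul_le_mul (by simpa using padicNorm.of_nat (p := p) 2) hl
              (padicNorm.nonneg _) zero_le_one) (padicNorm_classRho_le_one b h0 hqN hn hp2 (σ + 1)) (padicNorm.nonneg _)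
              (by positivity)
          _ = 1 := by ring
      · rw [padicNorm.zero]; exact zero_le_one
    · split_ifs
      · exact padicNorm_classRho_le_one b h0 hqN hn hp2 (σ + 2)
      · rw [padicNorm.zero]; exact zero_le_one
  rw [padicNorm.mul, padicNorm.mul, padicNorm_pow_eq, padicNorm.neg, padicNorm.one, one_pow, one_mul]
  calc _ ≤ (1 : ℚ) * 1 := mul_le_mul hin (padicNorm_harm_le_one hlp σ) (padicNorm.nonneg _) zero_le_one
    _ = 1 := one_mul _

/-! ## §4 Conjugation symmetry of all six functionals for palindromic classes -/

section Conj

variable (b : ℕ → ℤ) (hb : InPolytope b) (hpn : (p : ℤ) ≤ b 0) {x : ℕ} (hx : x < p) (hc : ¬ CentreIn b p x)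
  (hpal : (classTypeList b p x).reverse = classTypeList b p x)
include hb hpn hx hc hpal

/-- **A palindromic non-self-conjugate class and its conjugate have the same `ŵ, ŵ₂, ŵ₃, v̂, v̂₂, v̂₃` and the same top level.** -/
theorem functionals_conj_of_pal :
    wHat b p (conjClass b p x) = wHat b p x ∧ wHat2 b p (conjClass b p x) = wHat2 b p x ∧
      wHat3 b p (conjClass b p x) = wHat3 b p x ∧ vHat b p (conjClass b p x) = vHat b p x ∧
      vHat2 b p (conjClass b p x) = vHat2 b p x ∧ vHat3 b p (conjClass b p x) = vHat3 b p x ∧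
      topLevel b p (conjClass b p x) = topLevel b p x := by
  have h0 : 0 ≤ b 0 := hb.1.1
  have hxn := le_b0_of_lt b hpn hx
  obtain ⟨hL, hL'⟩ := level_bounds' (p := p) b hxn
  obtain ⟨htop, he⟩ := spec_of_typeList b hxn (T := classTypeList b p x) rfl
  set L := topLevel b p x with hLdef
  set f : ℕ → ℤ := fun k => netExp b (x + k * p) with hfdef
  have hf : ∀ k ≤ L, netExp b (x + k * p) = f k := fun k _ => rfl
  have hpalf : ∀ k ≤ L, f (L - k) = f k := by
    intro k hk
    show netExp b (x + (L - k) * p) = netExp b (x + k * p)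
    rw [he k hk, he (L - k) (by omega), ← htop]
    exact tList_pal hpal k (by omega)
  obtain ⟨hx', hM2, hM2'⟩ := conj_level b hx hL hL'
  have hfc : ∀ k ≤ L, netExp b (conjClass b p x + k * p) = f (L - k) := fun k hk => netExp_conj_level b hL hL' h0 hk
  have hc0 : ¬ (¬ (2 : ℤ) ∣ b 0 ∧ CentreIn b p x) := fun h => hc h.2
  have hc0' : ¬ (¬ (2 : ℤ) ∣ b 0 ∧ CentreIn b p (conjClass b p x)) :=
    fun h => hc ((centreIn_conj_iff b h0 hxn).1 h.2)
  refine ⟨?_, ?_, ?_, ?_, ?_, ?_, ?_⟩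
  · rw [wHat_level₀ b hx' hM2 hM2' _ hfc hc0', wHat_level₀ b hx hL hL' f hf hc0]; exact typeW_congr hpalf
  · rw [wHat2_level₀ b hx' hM2 hM2' _ hfc hc0', wHat2_level₀ b hx hL hL' f hf hc0]; exact typeW2_congr hpalf
  · rw [wHat3_level₀ b hx' hM2 hM2' _ hfc hc0', wHat3_level₀ b hx hL hL' f hf hc0]; exact typeW3_congr hpalf
  · rw [vHat_level₀ b hx' hM2 hM2' _ hfc hc0', vHat_level₀ b hx hL hL' f hf hc0]; exact typeV_congr hpalf
  · rw [vHat2_level₀ b hx' hM2 hM2' _ hfc hc0', vHat2_level₀ b hx hL hL' f hf hc0]; exact typeV2_congr hpalf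
  · rw [vHat3_level₀ b hx' hM2 hM2' _ hfc hc0', vHat3_level₀ b hx hL hL' f hf hc0]; exact typeV3_congr hpalf
  · rw [topLevel_level b hM2 hM2']

end Conj

end Summit.KontsevichZagierPeriods.Zeta5Search.SecondOrder

end
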